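import Literature.AlgebraicGeometry.HodgeTheory.WeilClassesCyclicPrym
import Literature.AlgebraicGeometry.HodgeTheory.AbelianVarietyEndomorphismsHOne
import Literature.AlgebraicGeometry.Motives.AbelianVarietyCohomologyExteriorH1
import HarnessLib

/-!
# Schoen's cyclic Prym fact, typed: the typed plane IS the Weil plane `E₊ ⊔ E₋` of `(B, ψ₀)`

Family `hodge`, layer `Literature/AlgebraicGeometry/HodgeTheory`; a theorem-only companion of
`WeilClassesCyclicPrym` (the named fact
`Schoen1988_cyclicPrym_weilClasses_algebraic_degreeSix`: Schoen 1988, Cor. 3.1 with Thm. 2.0 =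
Patel–Zhang 2025, Thm. 5.3, for the étale cyclic cover of degree `6` of a genus-`5` curve).
Everything here is PROVED; no definition, no new named fact.

The fact types Schoen's `U_prim ⊗ ℂ = ⋀⁸ H¹(B)_{ζ₆} ⊕ ⋀⁸ H¹(B)_{ζ₆⁻¹} ⊂ H⁸(B(ℂ); ℂ)` (Patel–Zhang
§2.6; van Geemen 4.9) as the sum of the two eigenspaces of the SINGLE pull-back `(2·𝟙_B + ψ₀)^*` on
`H⁸(B(ℂ); ℂ)` for `(2 ± i√3)⁸`, `ψ₀ = 𝟙 + 2 s_B²` (`ψ₀² = -3`), and its docstring marks this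
"TYPING (bookkeeping NOT in print)". The tree's standard Weil-class vocabulary (`WeilClasses`:
`E₊ = weilClassesPlus A φ n d`, `E₋`, `weilClassesOf = E₊ ⊔ E₋`, cut out by ALL the test pull-backs
`(x·𝟙 + y·φ)^*`, `x y : ℕ`) is the one in which the Weil-class results of the tree are stated
(`Markman2025_weilClasses_algebraic_abelianFourfold`, `…_hyperbolicSixfold`, the isogeny descent of
`WeilClassesIsogenyDescent`, the dimension count `finrank_weilClassesOf_eq_two` and the conjugation
symmetry of `AbelianVarietyEndomorphismsHOne`). This file proves that the two typings agree and draws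
the consequences for the fact, using `H•(A(ℂ); ℂ) = ⋀• H¹` — now a THEOREM for complex abelian
varieties (`Motives.abelianVarietyCohomologyExteriorH1_holds`).

## What is proved

* `forall_apply_eq_smul_iff_mem_span_image` — joint eigenvectors of a commuting family diagonal in a
  basis `B`, for a character `χ`, are exactly the span of the `B j` of character `χ` (linear algebra;
  generalises `forall_apply_eq_smul_iff_mem_span_singleton`).
* **`eigenspace_map_nsmul_id_add_nsmul_eq_pullbackEigenclasses`** (general `(A, φ, n, d)`,
  `φ ≫ φ = -d`, `d ≥ 1`, `μ = ± i√d`): for ONE test endomorphism `x₀·𝟙 + y₀·φ` whose values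
  `σ = x₀ + y₀μ`, `τ = x₀ - y₀μ` SEPARATE in degree `2n` (`σᵃτᵇ ≠ σ²ⁿ` for `a + b = 2n`, `b ≥ 1`),
  `Eig((x₀·𝟙 + y₀·φ)^*|H²ⁿ, σ²ⁿ) = pullbackEigenclasses A φ (2n) ((x + yμ)²ⁿ)` — both are the span
  of the wedge-basis vectors `⌣_{i∈S} bᵢ` with all `bᵢ ∈ V_μ`, in an eigenbasis of
  `H¹ = V_μ ⊕ V_{-μ}` (van Geemen, proof of Thm. 6.12: "`⋀ᵃ W ⊗ ⋀ᵇ W^*` … the cases `a = 0, 2n`").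
* `weilClassesOf_le_algebraicClasses_of_exists_mem_weilClassesPlus` / `…Minus` — granted
  `b₁ = 4n` (i.e. `dim A = 2n`): ONE non-zero algebraic class in `E₊` (or `E₋`) makes the whole Weil
  plane algebraic (the lines `E±`, `finrank_weilClassesPlus_eq_one`, and complex conjugation,
  `exists_mem_weilClassesMinus_mem_algebraicClasses`) — the shape in which Schoen (Lemma 1.2:
  `U` is a `ℚ(μ_m)`-line; proof of Thm. 2.0, `r = 0`, p. 13: the class of `z_χ` is non-trivial)
  and Patel–Zhang (Thm. 4.4) conclude; and
  `weilClassesOf_le_algebraicClasses_of_weilClassesPlus_le` — it suffices to treat `E₊` (no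
  dimension hypothesis).
* Arithmetic of `2 ± i√3` (`pow_sub_pow_eq_of_add_eq_four_of_mul_eq_seven`: the Lucas differences
  `sᵇ - tᵇ = U_b (s - t)`, `U_b = 1, 4, 9, 8, -31, -180, -503, -752`, for the roots of
  `X² - 4X + 7`; `two_sub_I_mul_sqrt_three_pow_ne`: `(2 - i√3)ᵇ ≠ (2 + i√3)ᵇ`, `1 ≤ b ≤ 8`;
  `separation_two_add`): the test endomorphism `2·𝟙 + ψ₀` of the fact separates in degree `8`.
* **`eigenspace_two_add_weilOperator_eq_weilClassesPlus` / `…Minus`,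
  `eigenspace_sup_eigenspace_eq_weilClassesOf`**: for every complex abelian variety `B` with
  `H•(B(ℂ)) = ⋀• H¹` and every `ψ₀` with `ψ₀ ≫ ψ₀ = -3`,
  `Eig((2·𝟙 + ψ₀)^*|H⁸, (2 ± i√3)⁸) = E±(B, ψ₀; n = 4, d = 3)` and the typed plane is
  `weilClassesOf B ψ₀ 4 3`.
* `finrank_eigenspace_sup_eigenspace_eq_two` — if `dim B = 8` the typed plane is a plane and the two
  eigenspaces are lines (as asserted in the fact's docstring; `dim B = 8` itself is NOT proved here).
* **`Schoen1988_cyclicPrym_weilClasses_algebraic_degreeSix_iff_weilClassesOf`** — the named fact is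
  EQUIVALENT to its Weil-plane form "`weilClassesOf B ψ₀ 4 3 ≤ algebraicClasses B.X 4` for Schoen's
  `B = (ker Φ₆(α_*))⁰`, `ψ₀ = 𝟙 + 2s_B²`"; `…_of_plus` — it suffices to prove it on the `+`-eigenspace;
  **`…_of_dim_eq_eight_of_exists`** — it FOLLOWS from (1) `dim B = 8` and (2) ONE non-zero algebraic
  class in `E₊(B, ψ₀)`. These two inputs are exactly what the printed proof supplies and the tree
  lacks: (1) is Chevalley–Weil for the étale `ℤ/6`-cover together with `H¹(J(C)) ≅ H¹(C)` (the named
  fact `Motives.isIso_bettiCohomology_map_abelJacobi`) and the dictionary `H₁((ker g)⁰) = ker g_*`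
  (Patel–Zhang Lemma 2.9 / 5.1; Schoen Lemma 1.5–1.6); (2) is Schoen's cycle — a component of the
  pull-back of `|K_{C''}| ≅ ℙ⁴ ⊂ Sym⁸ C''` along the geometric class-field-theory square, pushed to
  `B` (Schoen Thm. 2.0 and Cor. 3.1 via Poincaré's formula and Lieberman; Patel–Zhang Prop. 3.1–3.2,
  Lemma 4.3, Thm. 4.4) — symmetric powers of curves with their Abel–Jacobi bundle structure,
  Macdonald's `H•(Symʰ C)`, the Leray / projective-bundle computation and `B(A)` for Betti cohomology,
  none of which the tree has yet.

## References

* [Schoen1988HodgeWeil] C. Schoen, *Hodge classes on self-products of a variety with an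
  automorphism*, Compositio Math. 65 (1988) 3–32: §1 Lemmas 1.2, 1.5, 1.6; Thm. 2.0 (p. 11); §3,
  Cor. 3.1 (p. 24). Read on Numdam (`paper:url-b5113a48d801`).
* [PatelZhang2025PrymHodge] D. Patel, Y. Zhang, arXiv:2506.13729 (2025): Lemma 2.9, §2.6, Prop.
  3.1–3.2, Lemma 4.3, Thm. 4.4, Lemma 5.1, Thm. 5.3. Held: `paper:arxiv-2506.13729`.
* [vanGeemen1994HodgeAV] B. van Geemen, LNM 1594 (1994), 4.9, proof of Lemma 5.2 (6), proof of
  Thm. 6.12.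
-/

noncomputable section

open CategoryTheory

namespace Literature.AlgebraicGeometry.HodgeTheory

open Literature.AlgebraicTopology.SingularHomology
open Literature.AlgebraicGeometry Literature.AlgebraicGeometry.Motives

/-! ### Joint eigenvectors of a diagonal family: the span of the matching basis vectors -/

section Diagonal

variable {F V P J : Type*} [Field F] [AddCommGroup V] [Module F V]

/-- **Joint eigenvectors in a diagonal basis.** Let `B` be a basis in which every operator `T p`
is diagonal, `T p (B j) = c j p • B j`. Then `v` is a joint eigenvector for the character `χ`
(`T p v = χ p • v` for all `p`) iff `v` lies in the span of the basis vectors `B j` whose character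
is `χ` (`c j = χ`). (The case of a character matched by exactly one index is
`forall_apply_eq_smul_iff_mem_span_singleton`.) [folklore] -/
theorem forall_apply_eq_smul_iff_mem_span_image (B : Module.Basis J F V) (T : P → V →ₗ[F] V)
    (c : J → P → F) (hT : ∀ p j, T p (B j) = c j p • B j) (χ : P → F) (v : V) :
    (∀ p, T p v = χ p • v) ↔ v ∈ Submodule.span F (B '' {j | c j = χ}) := by
  classical
  constructor
  · intro h
    refine B.mem_span_image.2 fun j hj => ?_
    by_contra hne
    obtain ⟨p, hp⟩ := Function.ne_iff.mp hne
    have h0 : B.repr (T p v - χ p • v) j = 0 := by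
      rw [h p, sub_self, map_zero, Finsupp.zero_apply]
    rw [repr_apply_sub_smul_of_diagonal B T c hT χ p v j] at h0
    rcases mul_eq_zero.mp h0 with h1 | h1
    · exact hp (sub_eq_zero.mp h1)
    · exact (Finsupp.mem_support_iff.mp (Finset.mem_coe.mp hj)) h1
  · intro hv p
    refine Submodule.span_induction (p := fun w _ => T p w = χ p • w) ?_ ?_ ?_ ?_ hv
    · rintro _ ⟨j, hj, rfl⟩
      rw [hT, show c j = χ from hj]
    · rw [map_zero, smul_zero]
    · intro x y _ _ hx hy
      rw [map_add, hx, hy, smul_add]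
    · intro a x _ hx
      rw [map_smul, hx, smul_comm]

end Diagonal

/-! ### Products of `x₀ + y₀ λᵢ` over a family of signs -/

section Characters

/-- The product `∏ᵢ (x₀ + y₀ λᵢ)` over a finite family `λᵢ ∈ {μ, -μ}` is `σᵃ τᵇ`, `σ = x₀ + y₀ μ`,
`τ = x₀ - y₀ μ`, `a` the number of `λᵢ = μ`, `b` the number of `λᵢ ≠ μ`, and `a + b` is the size
of the family. [folklore] -/
theorem prod_add_mul_eq_pow_mul_pow {μ : ℂ} {N : ℕ} (lam : Fin N → ℂ)
    (hlam : ∀ i, lam i = μ ∨ lam i = -μ) (x₀ y₀ : ℂ) :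
    (∏ i, (x₀ + y₀ * lam i)) =
      (x₀ + y₀ * μ) ^ (Finset.univ.filter fun i : Fin N => lam i = μ).card *
        (x₀ - y₀ * μ) ^ (Finset.univ.filter fun i : Fin N => ¬ lam i = μ).card := by
  classical
  rw [← Finset.prod_filter_mul_prod_filter_not Finset.univ (fun i : Fin N => lam i = μ)]
  congr 1
  · rw [Finset.prod_congr rfl (fun i hi => by rw [(Finset.mem_filter.mp hi).2]), Finset.prod_const]
  · rw [Finset.prod_congr rfl (fun i hi => by
      rw [((hlam i).resolve_left (Finset.mem_filter.mp hi).2), mul_neg, ← sub_eq_add_neg]),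
      Finset.prod_const]

/-- The two exponents add up to the size of the family. [folklore] -/
theorem card_filter_add_card_filter_not_eq {μ : ℂ} {N : ℕ} (lam : Fin N → ℂ) :
    (Finset.univ.filter fun i : Fin N => lam i = μ).card +
      (Finset.univ.filter fun i : Fin N => ¬ lam i = μ).card = N := by
  classical
  rw [Finset.card_filter_add_card_filter_not, Finset.card_univ, Fintype.card_fin]

end Characters

/-! ### The eigenspace of ONE test pull-back `(x₀·𝟙 + y₀·φ)^*` versus the joint eigenclasses -/

section SingleOperator

variable {A : Motives.AbelianVariety ℂ}

/-- **One separating test endomorphism cuts out the Weil line.** Let `φ ≫ φ = -d`, `d ≥ 1`,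
`μ = ± i√d`, and `x₀, y₀ ∈ ℕ` with `σ := x₀ + y₀ μ`, `τ := x₀ - y₀ μ` SEPARATING in degree `2n`:
`σᵃ τᵇ ≠ σ²ⁿ` whenever `a + b = 2n`, `b ≥ 1`. Then the eigenspace of the single pull-back
`(x₀·𝟙 + y₀·φ)^*` on `H²ⁿ(A(ℂ); ℂ)` for the eigenvalue `σ²ⁿ` is exactly the space of joint
eigenclasses of all the `(x·𝟙 + y·φ)^*`, `x y : ℕ`, for the character `(x + yμ)²ⁿ`
(`pullbackEigenclasses`; for `μ = i√d` this is `E₊ = weilClassesPlus`, for `μ = -i√d` it is `E₋`).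
Proof: in an eigenbasis `b` of `H¹ = V_μ ⊕ V_{-μ}` the wedge basis `b_S = ⌣_{i∈S} bᵢ` of
`H²ⁿ = ⋀²ⁿ H¹` (hypothesis `hΛ` — a theorem for abelian varieties,
`Motives.AbelianVariety.hasExteriorCohomologyH1_complexPoints` — transported along `wedgeToCup`)
diagonalises every `(x·𝟙 + y·φ)^*` with character `∏_{i∈S} (x + yλᵢ) = (x + yμ)ᵃ (x - yμ)ᵇ`
(`a`, `b` the numbers of indices of `S` of eigenvalue `μ`, `-μ`); both spaces
are the span of the `b_S` with `b = 0`: for the joint eigenclasses because the characters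
`(x + yμ)ᵃ(x - yμ)ᵇ`, `b ≥ 1`, and `(x + yμ)²ⁿ` differ somewhere on `ℕ²`
(`exists_prod_natCast_add_mul_ne_pow`), for the single operator by the separation hypothesis.
[cite: vanGeemen1994HodgeAV, 4.9 and proof of Thm. 6.12] -/
theorem eigenspace_map_nsmul_id_add_nsmul_eq_pullbackEigenclasses
    (hΛ : HasExteriorCohomologyH1 ℂ (Motives.ComplexPoints A.X)) {n d : ℕ} (hd : 0 < d)
    {φ : A ⟶ A} (hφ : φ ≫ φ = -(d • 𝟙 A)) {μ : ℂ}
    (hμ : μ = Complex.I * (Real.sqrt d : ℂ) ∨ μ = -(Complex.I * (Real.sqrt d : ℂ))) (x₀ y₀ : ℕ)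
    (hsep : ∀ a b : ℕ, a + b = 2 * n → 0 < b →
      ((x₀ : ℂ) + (y₀ : ℂ) * μ) ^ a * ((x₀ : ℂ) - (y₀ : ℂ) * μ) ^ b ≠
        ((x₀ : ℂ) + (y₀ : ℂ) * μ) ^ (2 * n)) :
    Module.End.eigenspace (complexBetti.map (x₀ • 𝟙 A + y₀ • φ).hom.hom.hom (2 * n)).hom
        (((x₀ : ℂ) + (y₀ : ℂ) * μ) ^ (2 * n)) =
      pullbackEigenclasses A φ (2 * n) fun x y => ((x : ℂ) + (y : ℂ) * μ) ^ (2 * n) := by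
  classical
  haveI := finite_complexBetti_abelianVariety A 1
  set T := (complexBetti.map φ.hom.hom.hom 1).hom with hT
  have hμ0 : μ ≠ 0 := by
    rcases hμ with rfl | rfl
    · exact I_mul_sqrt_ne_zero hd
    · exact neg_ne_zero.mpr (I_mul_sqrt_ne_zero hd)
  have hcompl : IsCompl (Module.End.eigenspace T μ) (Module.End.eigenspace T (-μ)) := by
    rcases hμ with rfl | rfl
    · exact isCompl_eigenspace_eigenspace_neg hd hφ
    · rw [neg_neg]; exact (isCompl_eigenspace_eigenspace_neg hd hφ).symm
  -- an eigenbasis of `H¹ = V_μ ⊕ V_{-μ}`, the `μ`-vectors first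
  set p := Module.finrank ℂ (Module.End.eigenspace T μ) with hp
  set q := Module.finrank ℂ (Module.End.eigenspace T (-μ)) with hq
  let bp := Module.finBasis ℂ (Module.End.eigenspace T μ)
  let bm := Module.finBasis ℂ (Module.End.eigenspace T (-μ))
  let b₀ : Module.Basis (Fin p ⊕ Fin q) ℂ (complexBetti A.X 1) :=
    (bp.prod bm).map (Submodule.prodEquivOfIsCompl _ _ hcompl)
  let b : Module.Basis (Fin (p + q)) ℂ (complexBetti A.X 1) := b₀.reindex finSumFinEquiv
  let lam : Fin (p + q) → ℂ := fun i => Sum.elim (fun _ => μ) (fun _ => -μ) (finSumFinEquiv.symm i)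
  have hlam : ∀ i, lam i = μ ∨ lam i = -μ := fun i => by
    change Sum.elim (fun _ => μ) (fun _ => -μ) (finSumFinEquiv.symm i) = μ ∨
      Sum.elim (fun _ => μ) (fun _ => -μ) (finSumFinEquiv.symm i) = -μ
    rcases finSumFinEquiv.symm i with k | k
    · exact Or.inl rfl
    · exact Or.inr rfl
  have hb_mem : ∀ i, b i ∈ Module.End.eigenspace T (lam i) := by
    intro i
    rw [Module.Basis.reindex_apply]
    change b₀ (finSumFinEquiv.symm i) ∈
      Module.End.eigenspace T (Sum.elim (fun _ => μ) (fun _ => -μ) (finSumFinEquiv.symm i))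
    rcases finSumFinEquiv.symm i with k | k
    · simp only [Sum.elim_inl, b₀, Module.Basis.map_apply, Module.Basis.prod_apply, Function.comp_apply,
        LinearMap.inl_apply, Submodule.coe_prodEquivOfIsCompl', Submodule.coe_zero, add_zero]
      exact (bp k).2
    · simp only [Sum.elim_inr, b₀, Module.Basis.map_apply, Module.Basis.prod_apply, Function.comp_apply,
        LinearMap.inr_apply, Submodule.coe_prodEquivOfIsCompl', Submodule.coe_zero, zero_add]
      exact (bm k).2
  -- the wedge basis of `H²ⁿ` and the action of the test endomorphisms on it
  let Bw : Module.Basis (Set.powersetCard (Fin (p + q)) (2 * n)) ℂ (complexBetti A.X (2 * n)) :=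
    (b.exteriorPower (2 * n)).map (hΛ.equiv (2 * n))
  have hBw : ∀ S, Bw S = cupPowOne ℂ (Motives.ComplexPoints A.X) (2 * n)
      (b ∘ (Set.powersetCard.ofFinEmbEquiv.symm S)) := by
    intro S
    change hΛ.equiv (2 * n) ((b.exteriorPower (2 * n)) S) = _
    rw [exteriorPower.basis_apply, HasExteriorCohomologyH1.equiv_apply, exteriorPower.ιMulti_family,
      wedgeToCup_ιMulti]
  have hact : ∀ (pr : ℕ × ℕ) (S : Set.powersetCard (Fin (p + q)) (2 * n)),
      (complexBetti.map (pr.1 • 𝟙 A + pr.2 • φ).hom.hom.hom (2 * n)).hom (Bw S) =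
        (∏ i : Fin (2 * n), ((pr.1 : ℂ) + (pr.2 : ℂ) * lam (Set.powersetCard.ofFinEmbEquiv.symm S i))) •
          Bw S := by
    rintro ⟨x, y⟩ S
    rw [hBw]
    change singularCohomology.map ℂ ℂ
      (Motives.AlgPoints.mapContinuous (L := ℂ) (x • 𝟙 A + y • φ).hom.hom.hom) (2 * n)
        (cupPowOne ℂ _ (2 * n) _) = _
    rw [map_cupPowOne]
    have e : (fun i => singularCohomology.map ℂ ℂ
        (Motives.AlgPoints.mapContinuous (L := ℂ) (x • 𝟙 A + y • φ).hom.hom.hom) 1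
          ((b ∘ (Set.powersetCard.ofFinEmbEquiv.symm S)) i)) =
        fun i => ((x : ℂ) + (y : ℂ) * lam (Set.powersetCard.ofFinEmbEquiv.symm S i)) •
          (b ∘ (Set.powersetCard.ofFinEmbEquiv.symm S)) i := by
      funext i
      exact complexBetti_map_nsmul_id_add_nsmul_one_of_mem_eigenspace (hb_mem _) x y
    rw [e, MultilinearMap.map_smul_univ]
  -- the "good" indices: all `2n` eigenvalues equal to `μ`
  let good : Set (Set.powersetCard (Fin (p + q)) (2 * n)) :=
    {S | ∀ i : Fin (2 * n), lam (Set.powersetCard.ofFinEmbEquiv.symm S i) = μ}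
  have hgood_prod : ∀ S ∈ good, ∀ x y : ℂ,
      (∏ i : Fin (2 * n), (x + y * lam (Set.powersetCard.ofFinEmbEquiv.symm S i))) =
        (x + y * μ) ^ (2 * n) := by
    intro S hS x y
    rw [Finset.prod_congr rfl (fun i _ => by rw [hS i]), Finset.prod_const, Finset.card_univ,
      Fintype.card_fin]
  -- joint eigenclasses: the character matches iff `S` is good
  have hχ : ∀ S : Set.powersetCard (Fin (p + q)) (2 * n),
      ((fun pr : ℕ × ℕ => ∏ i : Fin (2 * n),
          ((pr.1 : ℂ) + (pr.2 : ℂ) * lam (Set.powersetCard.ofFinEmbEquiv.symm S i))) =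
        fun pr : ℕ × ℕ => ((pr.1 : ℂ) + (pr.2 : ℂ) * μ) ^ (2 * n)) ↔ S ∈ good := by
    intro S
    constructor
    · intro h
      by_contra hne
      obtain ⟨i₀, hi₀⟩ : ∃ i, lam (Set.powersetCard.ofFinEmbEquiv.symm S i) ≠ μ := by
        by_contra! hall
        exact hne hall
      have hneg : ∃ k, (lam ∘ Set.powersetCard.ofFinEmbEquiv.symm S) k = -μ :=
        ⟨i₀, (hlam _).resolve_left hi₀⟩
      obtain ⟨x, y, hxy⟩ := exists_prod_natCast_add_mul_ne_pow hμ0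
        (lam ∘ Set.powersetCard.ofFinEmbEquiv.symm S) (fun k => hlam _) hneg
      exact hxy (congrFun h (x, y))
    · intro hS
      funext pr
      exact hgood_prod S hS _ _
  -- the single operator: the eigenvalue matches iff `S` is good (separation hypothesis)
  have hχ₀ : ∀ S : Set.powersetCard (Fin (p + q)) (2 * n),
      (∏ i : Fin (2 * n), ((x₀ : ℂ) + (y₀ : ℂ) * lam (Set.powersetCard.ofFinEmbEquiv.symm S i))) =
        ((x₀ : ℂ) + (y₀ : ℂ) * μ) ^ (2 * n) ↔ S ∈ good := by
    intro S
    constructor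
    · intro h
      by_contra hne
      obtain ⟨i₀, hi₀⟩ : ∃ i, lam (Set.powersetCard.ofFinEmbEquiv.symm S i) ≠ μ := by
        by_contra! hall
        exact hne hall
      rw [prod_add_mul_eq_pow_mul_pow (fun k => lam (Set.powersetCard.ofFinEmbEquiv.symm S k))
        (fun k => hlam _)] at h
      refine hsep _ _ (card_filter_add_card_filter_not_eq
        (fun k => lam (Set.powersetCard.ofFinEmbEquiv.symm S k))) (Finset.card_pos.mpr ⟨i₀, ?_⟩) h
      rw [Finset.mem_filter]
      exact ⟨Finset.mem_univ _, hi₀⟩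
    · intro hS
      exact hgood_prod S hS _ _
  -- both spaces are the span of the good wedge basis vectors
  ext c
  rw [Module.End.mem_eigenspace_iff, mem_pullbackEigenclasses_iff]
  have h1 := forall_apply_eq_smul_iff_mem_span_image (P := Unit) Bw
    (fun _ => (complexBetti.map (x₀ • 𝟙 A + y₀ • φ).hom.hom.hom (2 * n)).hom)
    (fun S _ => ∏ i : Fin (2 * n),
      ((x₀ : ℂ) + (y₀ : ℂ) * lam (Set.powersetCard.ofFinEmbEquiv.symm S i)))
    (fun _ S => hact (x₀, y₀) S) (fun _ => ((x₀ : ℂ) + (y₀ : ℂ) * μ) ^ (2 * n)) c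
  have h2 := forall_apply_eq_smul_iff_mem_span_image (P := ℕ × ℕ) Bw
    (fun pr => (complexBetti.map (pr.1 • 𝟙 A + pr.2 • φ).hom.hom.hom (2 * n)).hom)
    (fun S pr => ∏ i : Fin (2 * n),
      ((pr.1 : ℂ) + (pr.2 : ℂ) * lam (Set.powersetCard.ofFinEmbEquiv.symm S i)))
    hact (fun pr => ((pr.1 : ℂ) + (pr.2 : ℂ) * μ) ^ (2 * n)) c
  have hs1 : {S : Set.powersetCard (Fin (p + q)) (2 * n) |
      (fun _ : Unit => ∏ i : Fin (2 * n),
        ((x₀ : ℂ) + (y₀ : ℂ) * lam (Set.powersetCard.ofFinEmbEquiv.symm S i))) =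
        fun _ : Unit => ((x₀ : ℂ) + (y₀ : ℂ) * μ) ^ (2 * n)} = good := by
    ext S
    rw [Set.mem_setOf_eq, funext_iff, ← hχ₀ S]
    exact ⟨fun h => h (), fun h _ => h⟩
  have hs2 : {S : Set.powersetCard (Fin (p + q)) (2 * n) |
      (fun pr : ℕ × ℕ => ∏ i : Fin (2 * n),
        ((pr.1 : ℂ) + (pr.2 : ℂ) * lam (Set.powersetCard.ofFinEmbEquiv.symm S i))) =
        fun pr : ℕ × ℕ => ((pr.1 : ℂ) + (pr.2 : ℂ) * μ) ^ (2 * n)} = good := by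
    ext S
    exact hχ S
  rw [hs1] at h1
  rw [hs2] at h2
  constructor
  · intro hc x y
    exact (h2.2 (h1.1 fun _ => hc)) (x, y)
  · intro hc
    exact (h1.2 (h2.1 fun pr => hc pr.1 pr.2)) ()

end SingleOperator

/-! ### One non-zero algebraic class in `E₊` makes the whole Weil plane algebraic -/

section OneClass

variable {A : Motives.AbelianVariety ℂ}

/-- **Algebraicity of the Weil plane from ONE class.** For `φ ≫ φ = -d`, `d ≥ 1`, on an abelian
variety with `H•(A(ℂ)) = ⋀• H¹` and `b₁ = 4n` (both hold when `dim A = 2n`: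
`Motives.abelianVarietyCohomologyExteriorH1_holds`), if the Weil line `E₊` contains ONE non-zero
algebraic class then the whole Weil plane `E₊ ⊔ E₋` consists of algebraic classes: `E₊` is the line
through that class (`weilClassesPlus_le_span_singleton`), and its complex conjugate is a non-zero
algebraic class spanning `E₋` (`exists_mem_weilClassesMinus_mem_algebraicClasses`). This is the
shape in which Schoen concludes (1988, Lemma 1.2: "The action of `ℤ/m` makes `U` a one dimensional
`ℚ(μ_m)`-vector space"; proof of Thm. 2.0 for `r = 0`, p. 13: "the cohomology class of `z_χ` is
non-trivial and lies in `U ⊗ ℚ(μ_m)` … `U ⊗ ℚ(μ_m)` is generated by the "eigenvectors" `z_χ`"), as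
do Patel–Zhang (2025, proof of Thm. 4.4).
[cite: Schoen1988HodgeWeil, §1 Lemma 1.2 and §2 p. 13 (proof of Thm. 2.0, case r = 0)] -/
theorem weilClassesOf_le_algebraicClasses_of_exists_mem_weilClassesPlus {n d : ℕ}
    (hΛ : HasExteriorCohomologyH1 ℂ (Motives.ComplexPoints A.X))
    (hb₁ : Module.finrank ℂ (complexBetti A.X 1) = 2 * (2 * n)) (hd : 0 < d) {φ : A ⟶ A}
    (hφ : φ ≫ φ = -(d • 𝟙 A))
    (h : ∃ c ∈ weilClassesPlus A φ n d, c ∈ algebraicClasses A.X n ∧ c ≠ 0) :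
    weilClassesOf A φ n d ≤ algebraicClasses A.X n := by
  obtain ⟨c₂, h₂, ha₂, h0₂⟩ := exists_mem_weilClassesMinus_mem_algebraicClasses h
  obtain ⟨c₁, h₁, ha₁, h0₁⟩ := h
  refine sup_le ?_ ?_
  · exact (weilClassesPlus_le_span_singleton hΛ hb₁ hd hφ h₁ h0₁).trans
      ((Submodule.span_singleton_le_iff_mem _ _).2 ha₁)
  · exact (weilClassesMinus_le_span_singleton hΛ hb₁ hd hφ h₂ h0₂).trans
      ((Submodule.span_singleton_le_iff_mem _ _).2 ha₂)

/-- The same from one non-zero algebraic class in `E₋`.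
[cite: Schoen1988HodgeWeil, §1 Lemma 1.2 and §2 p. 13 (proof of Thm. 2.0, case r = 0)] -/
theorem weilClassesOf_le_algebraicClasses_of_exists_mem_weilClassesMinus {n d : ℕ}
    (hΛ : HasExteriorCohomologyH1 ℂ (Motives.ComplexPoints A.X))
    (hb₁ : Module.finrank ℂ (complexBetti A.X 1) = 2 * (2 * n)) (hd : 0 < d) {φ : A ⟶ A}
    (hφ : φ ≫ φ = -(d • 𝟙 A))
    (h : ∃ c ∈ weilClassesMinus A φ n d, c ∈ algebraicClasses A.X n ∧ c ≠ 0) :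
    weilClassesOf A φ n d ≤ algebraicClasses A.X n :=
  weilClassesOf_le_algebraicClasses_of_exists_mem_weilClassesPlus hΛ hb₁ hd hφ
    (exists_mem_weilClassesPlus_mem_algebraicClasses h)

/-- **It suffices to treat `E₊`**: if every class of the Weil line `E₊` is algebraic, so is every
class of the Weil plane `E₊ ⊔ E₋` — complex conjugation maps `E₋` into `E₊`, is an involution,
and preserves the algebraic classes of the smooth projective `A` (`conjClass_mem_weilClassesPlus`,
`conjClass_mem_algebraicClasses_abelianVariety`; no dimension hypothesis).
[cite: vanGeemen1994HodgeAV, proof of Lemma 5.2 (6)] -/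
theorem weilClassesOf_le_algebraicClasses_of_weilClassesPlus_le {n d : ℕ} {φ : A ⟶ A}
    (h : weilClassesPlus A φ n d ≤ algebraicClasses A.X n) :
    weilClassesOf A φ n d ≤ algebraicClasses A.X n := by
  refine sup_le h fun c hc => ?_
  have h' := conjClass_mem_algebraicClasses_abelianVariety (h (conjClass_mem_weilClassesPlus hc))
  rwa [conjClass_conjClass] at h'

/-- … or `E₋`. [cite: vanGeemen1994HodgeAV, proof of Lemma 5.2 (6)] -/
theorem weilClassesOf_le_algebraicClasses_of_weilClassesMinus_le {n d : ℕ} {φ : A ⟶ A}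
    (h : weilClassesMinus A φ n d ≤ algebraicClasses A.X n) :
    weilClassesOf A φ n d ≤ algebraicClasses A.X n := by
  refine sup_le (fun c hc => ?_) h
  have h' := conjClass_mem_algebraicClasses_abelianVariety (h (conjClass_mem_weilClassesMinus hc))
  rwa [conjClass_conjClass] at h'

end OneClass

/-! ### The arithmetic of `2 ± i√3`: separation in degree `8` -/

section Numerics

/-- **Lucas differences for the roots of `X² - 4X + 7`** (`s + t = 4`, `st = 7`, e.g.
`s, t = 2 ± i√3`): `sᵇ - tᵇ = U_b · (s - t)` with `U_b = 4, 9, 8, -31, -180, -503, -752` for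
`b = 2, …, 8` (`U₁ = 1`, `U_{b+2} = 4U_{b+1} - 7U_b`). [folklore] -/
theorem pow_sub_pow_eq_of_add_eq_four_of_mul_eq_seven {s t : ℂ} (hs : s + t = 4) (hp : s * t = 7) :
    s ^ 2 - t ^ 2 = 4 * (s - t) ∧ s ^ 3 - t ^ 3 = 9 * (s - t) ∧ s ^ 4 - t ^ 4 = 8 * (s - t) ∧
      s ^ 5 - t ^ 5 = -31 * (s - t) ∧ s ^ 6 - t ^ 6 = -180 * (s - t) ∧
      s ^ 7 - t ^ 7 = -503 * (s - t) ∧ s ^ 8 - t ^ 8 = -752 * (s - t) := by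
  have h2 : s ^ 2 - t ^ 2 = 4 * (s - t) := by linear_combination (s - t) * hs
  have h3 : s ^ 3 - t ^ 3 = 9 * (s - t) := by
    linear_combination (s ^ 2 - t ^ 2) * hs - (s - t) * hp + 4 * h2
  have h4 : s ^ 4 - t ^ 4 = 8 * (s - t) := by
    linear_combination (s ^ 3 - t ^ 3) * hs - (s ^ 2 - t ^ 2) * hp + 4 * h3 - 7 * h2
  have h5 : s ^ 5 - t ^ 5 = -31 * (s - t) := by
    linear_combination (s ^ 4 - t ^ 4) * hs - (s ^ 3 - t ^ 3) * hp + 4 * h4 - 7 * h3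
  have h6 : s ^ 6 - t ^ 6 = -180 * (s - t) := by
    linear_combination (s ^ 5 - t ^ 5) * hs - (s ^ 4 - t ^ 4) * hp + 4 * h5 - 7 * h4
  have h7 : s ^ 7 - t ^ 7 = -503 * (s - t) := by
    linear_combination (s ^ 6 - t ^ 6) * hs - (s ^ 5 - t ^ 5) * hp + 4 * h6 - 7 * h5
  have h8 : s ^ 8 - t ^ 8 = -752 * (s - t) := by
    linear_combination (s ^ 7 - t ^ 7) * hs - (s ^ 6 - t ^ 6) * hp + 4 * h7 - 7 * h6
  exact ⟨h2, h3, h4, h5, h6, h7, h8⟩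

/-- **`(2 - i√3)ᵇ ≠ (2 + i√3)ᵇ` for `1 ≤ b ≤ 8`**: `(2 + i√3)/(2 - i√3) = (1 + 4i√3)/7` is not a root
of unity of order `≤ 8` (in fact of any order: it is not an algebraic integer); here read off the
Lucas differences `U_b ≠ 0`. [folklore] -/
theorem two_sub_I_mul_sqrt_three_pow_ne {b : ℕ} (hb : 0 < b) (hb8 : b ≤ 8) :
    (2 - Complex.I * (Real.sqrt (3 : ℝ) : ℂ)) ^ b ≠ (2 + Complex.I * (Real.sqrt (3 : ℝ) : ℂ)) ^ b := by
  set r : ℂ := Complex.I * (Real.sqrt (3 : ℝ) : ℂ) with hr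
  have hr2 : r ^ 2 = -3 := by
    have h := I_mul_sqrt_sq 3
    rw [Nat.cast_ofNat, Nat.cast_ofNat] at h
    exact h
  have hr0 : r ≠ 0 := by
    have h := I_mul_sqrt_ne_zero (d := 3) (by norm_num)
    rw [Nat.cast_ofNat] at h
    exact h
  have hs : (2 + r) + (2 - r) = 4 := by ring
  have hp : (2 + r) * (2 - r) = 7 := by linear_combination (-1 : ℂ) * hr2
  have hst : (2 + r) - (2 - r) ≠ 0 := by
    rw [show (2 + r) - (2 - r) = 2 * r by ring]
    exact mul_ne_zero two_ne_zero hr0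
  obtain ⟨h2, h3, h4, h5, h6, h7, h8⟩ := pow_sub_pow_eq_of_add_eq_four_of_mul_eq_seven hs hp
  intro h
  have h0 : (2 + r) ^ b - (2 - r) ^ b = 0 := by rw [h, sub_self]
  interval_cases b
  · rw [pow_one, pow_one] at h0
    exact hst h0
  · rw [h2] at h0; exact mul_ne_zero (by norm_num) hst h0
  · rw [h3] at h0; exact mul_ne_zero (by norm_num) hst h0
  · rw [h4] at h0; exact mul_ne_zero (by norm_num) hst h0
  · rw [h5] at h0; exact mul_ne_zero (by norm_num) hst h0
  · rw [h6] at h0; exact mul_ne_zero (by norm_num) hst h0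
  · rw [h7] at h0; exact mul_ne_zero (by norm_num) hst h0
  · rw [h8] at h0; exact mul_ne_zero (by norm_num) hst h0

/-- `2 ± i√3 ≠ 0` (real part `2`). [folklore] -/
theorem two_add_ne_zero_of_eq_or {μ : ℂ}
    (hμ : μ = Complex.I * (Real.sqrt (3 : ℝ) : ℂ) ∨ μ = -(Complex.I * (Real.sqrt (3 : ℝ) : ℂ))) :
    (2 : ℂ) + μ ≠ 0 := by
  intro h
  have h2 := congrArg Complex.re h
  rcases hμ with rfl | rfl <;> simp at h2

/-- **Separation in degree `8`** for `σ = 2 + μ`, `τ = 2 - μ`, `μ = ± i√3`: `σᵃ τᵇ ≠ σ⁸` whenever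
`a + b = 8`, `b ≥ 1` — the hypothesis of `eigenspace_map_nsmul_id_add_nsmul_eq_pullbackEigenclasses`
for the test endomorphism `2·𝟙 + ψ₀` of Schoen's fact. [folklore] -/
theorem separation_two_add (μ : ℂ)
    (hμ : μ = Complex.I * (Real.sqrt (3 : ℝ) : ℂ) ∨ μ = -(Complex.I * (Real.sqrt (3 : ℝ) : ℂ))) :
    ∀ a b : ℕ, a + b = 2 * 4 → 0 < b →
      (((2 : ℕ) : ℂ) + ((1 : ℕ) : ℂ) * μ) ^ a * (((2 : ℕ) : ℂ) - ((1 : ℕ) : ℂ) * μ) ^ b ≠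
        (((2 : ℕ) : ℂ) + ((1 : ℕ) : ℂ) * μ) ^ (2 * 4) := by
  intro a b hab hb h
  simp only [Nat.cast_ofNat, Nat.cast_one, one_mul] at h
  have hσ : (2 : ℂ) + μ ≠ 0 := two_add_ne_zero_of_eq_or hμ
  have hb8 : b ≤ 8 := by omega
  -- cancel `σᵃ`: `τᵇ = σᵇ`
  have h' : ((2 : ℂ) - μ) ^ b = ((2 : ℂ) + μ) ^ b := by
    have e : ((2 : ℂ) + μ) ^ (2 * 4) = ((2 : ℂ) + μ) ^ a * ((2 : ℂ) + μ) ^ b := by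
      rw [← pow_add, hab]
    rw [e] at h
    exact mul_left_cancel₀ (pow_ne_zero _ hσ) h
  rcases hμ with rfl | rfl
  · exact two_sub_I_mul_sqrt_three_pow_ne hb hb8 h'
  · rw [sub_neg_eq_add, ← sub_eq_add_neg] at h'
    exact two_sub_I_mul_sqrt_three_pow_ne hb hb8 h'.symm

end Numerics

/-! ### Schoen's fact: the typed plane of `(B, ψ₀)` is the Weil plane `E₊ ⊔ E₋` with `n = 4`, `d = 3` -/

section CyclicPrym

variable {B : Motives.AbelianVariety ℂ} {ψ₀ : B ⟶ B}

/-- **`Eig((2·𝟙 + ψ₀)^*|H⁸, (2 + i√3)⁸) = E₊`**: for `ψ₀ ≫ ψ₀ = -3` the first typed eigenspace of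
`Schoen1988_cyclicPrym_weilClasses_algebraic_degreeSix` is the Weil line
`weilClassesPlus B ψ₀ 4 3 = ⋀⁸ H¹(B(ℂ); ℂ)_{i√3}` of the pair `(B, ψ₀)`, `K = ℚ(ψ₀) = ℚ(√-3)`
(granted `H•(B(ℂ)) = ⋀• H¹`, a theorem for abelian varieties). [cite: vanGeemen1994HodgeAV, 4.9 and proof of Thm. 6.12] -/
theorem eigenspace_two_add_weilOperator_eq_weilClassesPlus
    (hΛ : HasExteriorCohomologyH1 ℂ (Motives.ComplexPoints B.X)) (hψ : ψ₀ ≫ ψ₀ = -(3 • 𝟙 B)) :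
    Module.End.eigenspace (complexBetti.map ((2 : ℤ) • 𝟙 B + ψ₀).hom.hom.hom 8).hom
        ((2 + Complex.I * (Real.sqrt (3 : ℝ) : ℂ)) ^ 8) = weilClassesPlus B ψ₀ 4 3 := by
  have h := eigenspace_map_nsmul_id_add_nsmul_eq_pullbackEigenclasses hΛ (n := 4) (d := 3)
    (by norm_num) hψ (μ := Complex.I * (Real.sqrt (3 : ℝ) : ℂ)) (Or.inl rfl) 2 1
    (separation_two_add _ (Or.inl rfl))
  have hop : ((2 : ℤ) • 𝟙 B + ψ₀ : B ⟶ B) = (2 : ℕ) • 𝟙 B + (1 : ℕ) • ψ₀ := by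
    rw [one_smul, ofNat_zsmul]
  have hval : (2 + Complex.I * (Real.sqrt (3 : ℝ) : ℂ)) =
      ((2 : ℕ) : ℂ) + ((1 : ℕ) : ℂ) * (Complex.I * (Real.sqrt ((3 : ℕ) : ℝ) : ℂ)) := by
    push_cast; ring
  have e : (fun x y : ℕ => ((x : ℂ) + (y : ℂ) * Complex.I * (Real.sqrt ((3 : ℕ) : ℝ) : ℂ)) ^ (2 * 4)) =
      fun x y : ℕ => ((x : ℂ) + (y : ℂ) * (Complex.I * (Real.sqrt ((3 : ℕ) : ℝ) : ℂ))) ^ (2 * 4) := by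
    funext x y; rw [mul_assoc]
  rw [hop, hval]
  -- `√(3 : ℝ)` versus `√((3 : ℕ) : ℝ)`: definitionally equal numerals
  exact h.trans (by rw [weilClassesPlus, e]; rfl)

/-- **`Eig((2·𝟙 + ψ₀)^*|H⁸, (2 - i√3)⁸) = E₋ = weilClassesMinus B ψ₀ 4 3`** (`= ⋀⁸ H¹_{-i√3}`).
[cite: vanGeemen1994HodgeAV, 4.9 and proof of Thm. 6.12] -/
theorem eigenspace_two_add_weilOperator_eq_weilClassesMinus
    (hΛ : HasExteriorCohomologyH1 ℂ (Motives.ComplexPoints B.X)) (hψ : ψ₀ ≫ ψ₀ = -(3 • 𝟙 B)) :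
    Module.End.eigenspace (complexBetti.map ((2 : ℤ) • 𝟙 B + ψ₀).hom.hom.hom 8).hom
        ((2 - Complex.I * (Real.sqrt (3 : ℝ) : ℂ)) ^ 8) = weilClassesMinus B ψ₀ 4 3 := by
  have h := eigenspace_map_nsmul_id_add_nsmul_eq_pullbackEigenclasses hΛ (n := 4) (d := 3)
    (by norm_num) hψ (μ := -(Complex.I * (Real.sqrt (3 : ℝ) : ℂ))) (Or.inr rfl) 2 1
    (separation_two_add _ (Or.inr rfl))
  have hop : ((2 : ℤ) • 𝟙 B + ψ₀ : B ⟶ B) = (2 : ℕ) • 𝟙 B + (1 : ℕ) • ψ₀ := by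
    rw [one_smul, ofNat_zsmul]
  have hval : (2 - Complex.I * (Real.sqrt (3 : ℝ) : ℂ)) =
      ((2 : ℕ) : ℂ) + ((1 : ℕ) : ℂ) * (-(Complex.I * (Real.sqrt ((3 : ℕ) : ℝ) : ℂ))) := by
    push_cast; ring
  have e : (fun x y : ℕ => ((x : ℂ) - (y : ℂ) * Complex.I * (Real.sqrt ((3 : ℕ) : ℝ) : ℂ)) ^ (2 * 4)) =
      fun x y : ℕ => ((x : ℂ) + (y : ℂ) * (-(Complex.I * (Real.sqrt ((3 : ℕ) : ℝ) : ℂ)))) ^ (2 * 4) := by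
    funext x y; rw [mul_neg, ← sub_eq_add_neg, mul_assoc]
  rw [hop, hval]
  exact h.trans (by rw [weilClassesMinus, e]; rfl)

/-- **The typed plane of Schoen's fact IS the Weil plane of `(B, ψ₀)`**:
`Eig((2·𝟙 + ψ₀)^*, (2 + i√3)⁸) ⊔ Eig((2·𝟙 + ψ₀)^*, (2 - i√3)⁸) = weilClassesOf B ψ₀ 4 3 = E₊ ⊔ E₋`
in `H⁸(B(ℂ); ℂ)`, for any endomorphism `ψ₀` with `ψ₀ ≫ ψ₀ = -3` of any complex abelian variety `B`
with `H•(B(ℂ)) = ⋀• H¹` — the "TYPING (bookkeeping NOT in print)" paragraph of the fact's docstring,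
now a theorem: `U_prim ⊗ ℂ` in the tree's standard Weil-class vocabulary (van Geemen 4.9).
[cite: vanGeemen1994HodgeAV, 4.9 and proof of Thm. 6.12] -/
theorem eigenspace_sup_eigenspace_eq_weilClassesOf
    (hΛ : HasExteriorCohomologyH1 ℂ (Motives.ComplexPoints B.X)) (hψ : ψ₀ ≫ ψ₀ = -(3 • 𝟙 B)) :
    Module.End.eigenspace (complexBetti.map ((2 : ℤ) • 𝟙 B + ψ₀).hom.hom.hom 8).hom
          ((2 + Complex.I * (Real.sqrt (3 : ℝ) : ℂ)) ^ 8) ⊔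
        Module.End.eigenspace (complexBetti.map ((2 : ℤ) • 𝟙 B + ψ₀).hom.hom.hom 8).hom
          ((2 - Complex.I * (Real.sqrt (3 : ℝ) : ℂ)) ^ 8) =
      weilClassesOf B ψ₀ 4 3 := by
  rw [eigenspace_two_add_weilOperator_eq_weilClassesPlus hΛ hψ,
    eigenspace_two_add_weilOperator_eq_weilClassesMinus hΛ hψ]
  rfl

/-- `ψ₀ ≫ ψ₀ = -(3 • 𝟙 B)` for `B = (ker Φ₆(s))⁰`, `ψ₀ = 𝟙 + 2 s_B²`, in the Weil-class API shape
(`kerComponent_weilOperator_comp_self` gives `(-3 : ℤ) • 𝟙`). [cite: Schoen1988HodgeWeil, §3 (p. 24)] -/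
theorem kerComponent_weilOperator_comp_self' {J : AbelianVariety ℂ} {s : J ⟶ J}
    {sB ψ₀ : AbelianVariety.kerComponent (𝟙 J - s + s ≫ s) ⟶
      AbelianVariety.kerComponent (𝟙 J - s + s ≫ s)}
    (hsB : sB ≫ AbelianVariety.kerComponentι (𝟙 J - s + s ≫ s) =
      AbelianVariety.kerComponentι (𝟙 J - s + s ≫ s) ≫ s)
    (hψ₀ : ψ₀ = 𝟙 _ + 2 • (sB ≫ sB)) :
    ψ₀ ≫ ψ₀ = -(3 • 𝟙 _) := by
  rw [kerComponent_weilOperator_comp_self hsB hψ₀, neg_zsmul, ofNat_zsmul]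

end CyclicPrym

/-! ### Consequences for the named fact -/

section SchoenFact

variable {B : Motives.AbelianVariety ℂ} {ψ₀ : B ⟶ B}

/-- **`dim B = 8` makes the typed plane a PLANE**: if Schoen's primitive Prym has dimension `8`
(as it does: `h · φ(6) / 2 = 8 · 2 / 2`, Schoen 1988 §3 / Patel–Zhang Lemma 5.1 — NOT proved in the
tree, which lacks the Chevalley–Weil multiplicities and `H¹(J) ≅ H¹(C)`), then for `ψ₀ ≫ ψ₀ = -3`
each typed eigenspace `Eig((2·𝟙 + ψ₀)^*, (2 ± i√3)⁸)` is a line and their sum has dimension `2`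
(`b₁ = 16`, `H⁸ = ⋀⁸ H¹`: `Motives.abelianVarietyCohomologyExteriorH1_holds`).
[cite: vanGeemen1994HodgeAV, 4.9 and proof of Thm. 6.12] [cite: PatelZhang2025PrymHodge, Lemma 5.1 and §2.6] -/
theorem finrank_eigenspace_sup_eigenspace_eq_two (hdim : B.dim = 8) (hψ : ψ₀ ≫ ψ₀ = -(3 • 𝟙 B)) :
    Module.finrank ℂ
        ↥(Module.End.eigenspace (complexBetti.map ((2 : ℤ) • 𝟙 B + ψ₀).hom.hom.hom 8).hom
              ((2 + Complex.I * (Real.sqrt (3 : ℝ) : ℂ)) ^ 8) ⊔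
          Module.End.eigenspace (complexBetti.map ((2 : ℤ) • 𝟙 B + ψ₀).hom.hom.hom 8).hom
              ((2 - Complex.I * (Real.sqrt (3 : ℝ) : ℂ)) ^ 8)) = 2 ∧
      Module.finrank ℂ
        ↥(Module.End.eigenspace (complexBetti.map ((2 : ℤ) • 𝟙 B + ψ₀).hom.hom.hom 8).hom
              ((2 + Complex.I * (Real.sqrt (3 : ℝ) : ℂ)) ^ 8)) = 1 ∧
      Module.finrank ℂ
        ↥(Module.End.eigenspace (complexBetti.map ((2 : ℤ) • 𝟙 B + ψ₀).hom.hom.hom 8).hom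
              ((2 - Complex.I * (Real.sqrt (3 : ℝ) : ℂ)) ^ 8)) = 1 := by
  have hX := Motives.abelianVarietyCohomologyExteriorH1_holds
  have hΛ := hX.hasExteriorCohomologyH1 B
  have hb₁ : Module.finrank ℂ (complexBetti B.X 1) = 2 * (2 * 4) := by rw [hX.finrank_one B, hdim]
  refine ⟨?_, ?_, ?_⟩
  · rw [eigenspace_sup_eigenspace_eq_weilClassesOf hΛ hψ]
    exact finrank_weilClassesOf_eq_two hΛ hb₁ (by norm_num) (by norm_num) hψ
  · rw [eigenspace_two_add_weilOperator_eq_weilClassesPlus hΛ hψ]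
    exact finrank_weilClassesPlus_eq_one hΛ hb₁ (by norm_num) hψ
  · rw [eigenspace_two_add_weilOperator_eq_weilClassesMinus hΛ hψ]
    exact finrank_weilClassesMinus_eq_one hΛ hb₁ (by norm_num) hψ

/-- **Schoen's fact in the tree's Weil-class vocabulary.** The named fact
`Schoen1988_cyclicPrym_weilClasses_algebraic_degreeSix` is EQUIVALENT to: for the same data
`(C, 𝒥, α, s = α_*, B = (ker Φ₆(s))⁰, s_B, ψ₀ = 𝟙 + 2 s_B²)`, the Weil plane
`weilClassesOf B ψ₀ 4 3 = E₊ ⊔ E₋ ⊆ H⁸(B(ℂ); ℂ)` of the pair `(B, ψ₀)` (`ψ₀² = -3`,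
`K = ℚ(√-3) = ℚ(μ₆)`; `WeilClasses`) consists of algebraic classes — i.e. the fact IS the statement
"`U_prim = ⋀⁸_K H¹(B_prim, ℚ)` is generated by algebraic cycles" (Patel–Zhang Thm. 5.3 "(Schoen88)",
Schoen Cor. 3.1) read through van Geemen's description `U_prim ⊗ ℂ = ⋀⁸ H¹_{ζ₆} ⊕ ⋀⁸ H¹_{ζ₆⁻¹} =
E₊ ⊕ E₋` (4.9, proof of Thm. 6.12), with no residual typing convention.
[cite: PatelZhang2025PrymHodge, Thm 5.3 and §2.6] [cite: Schoen1988HodgeWeil, Cor. 3.1 (p. 24) with Thm. 2.0] [cite: vanGeemen1994HodgeAV, 4.9] -/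
theorem Schoen1988_cyclicPrym_weilClasses_algebraic_degreeSix_iff_weilClassesOf :
    Schoen1988_cyclicPrym_weilClasses_algebraic_degreeSix ↔
    ∀ (C : SchemeOver ℂ) (𝒥 : Jacobian C) (α : C ⟶ C),
      IsSmoothProjective 1 C → 𝒥.J.dim = 25 →
      α ≫ α ≫ α ≫ α ≫ α ≫ α = 𝟙 C →
      (∀ P : ComplexPoints C, P ≫ (α ≫ α) ≠ P ∧ P ≫ (α ≫ α ≫ α) ≠ P) →
    ∀ (s : 𝒥.J ⟶ 𝒥.J), s = 𝒥.pushforward 𝒥 α →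
    ∀ (sB ψ₀ : AbelianVariety.kerComponent (𝟙 𝒥.J - s + s ≫ s) ⟶
        AbelianVariety.kerComponent (𝟙 𝒥.J - s + s ≫ s)),
      sB ≫ AbelianVariety.kerComponentι (𝟙 𝒥.J - s + s ≫ s) =
        AbelianVariety.kerComponentι (𝟙 𝒥.J - s + s ≫ s) ≫ s →
      ψ₀ = 𝟙 _ + 2 • (sB ≫ sB) →
      weilClassesOf (AbelianVariety.kerComponent (𝟙 𝒥.J - s + s ≫ s)) ψ₀ 4 3 ≤
        algebraicClasses (AbelianVariety.kerComponent (𝟙 𝒥.J - s + s ≫ s)).X 4 := by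
  have hX := Motives.abelianVarietyCohomologyExteriorH1_holds
  constructor
  · intro h C 𝒥 α hC h25 hα hfree s hs sB ψ₀ hsB hψ₀ c hc
    rw [← eigenspace_sup_eigenspace_eq_weilClassesOf (hX.hasExteriorCohomologyH1 _)
      (kerComponent_weilOperator_comp_self' hsB hψ₀)] at hc
    exact h C 𝒥 α hC h25 hα hfree s hs sB ψ₀ hsB hψ₀ c hc
  · intro h C 𝒥 α hC h25 hα hfree s hs sB ψ₀ hsB hψ₀ c hc
    rw [eigenspace_sup_eigenspace_eq_weilClassesOf (hX.hasExteriorCohomologyH1 _)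
      (kerComponent_weilOperator_comp_self' hsB hψ₀)] at hc
    exact h C 𝒥 α hC h25 hα hfree s hs sB ψ₀ hsB hψ₀ hc

/-- **What remains of Schoen's fact on the carriers: a DIMENSION and ONE CYCLE.** The named fact
follows as soon as, for the same data, (1) Schoen's primitive Prym `B = (ker Φ₆(α_*))⁰` has
dimension `8` (`= h·φ(6)/2`; Chevalley–Weil for the étale `ℤ/6`-cover with `H¹(J(C)) ≅ H¹(C)`,
Patel–Zhang Lemma 2.9 / 5.1, Schoen Lemma 1.5) and (2) the Weil line `E₊ = ⋀⁸ H¹(B)_{i√3}` contains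
ONE non-zero algebraic class (Schoen's cycle: the image in `B` of a component `Q` of the pulled-back
complete linear system `|K_{C''}| ≅ ℙ⁴ ⊂ Sym⁸ C''` along the class-field-theory square, Schoen
Thm. 2.0 / Cor. 3.1, Patel–Zhang Prop. 3.2–Thm. 4.4) — the line through it is `E₊`, its conjugate
spans `E₋` (`weilClassesOf_le_algebraicClasses_of_exists_mem_weilClassesPlus`). Neither (1) nor (2)
is proved here. [cite: Schoen1988HodgeWeil, Cor. 3.1 (p. 24), Thm. 2.0 (p. 11), Lemma 1.5] [cite: PatelZhang2025PrymHodge, Lemma 5.1, Thm 4.4, Thm 5.3] -/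
theorem Schoen1988_cyclicPrym_weilClasses_algebraic_degreeSix_of_dim_eq_eight_of_exists
    (h : ∀ (C : SchemeOver ℂ) (𝒥 : Jacobian C) (α : C ⟶ C),
      IsSmoothProjective 1 C → 𝒥.J.dim = 25 →
      α ≫ α ≫ α ≫ α ≫ α ≫ α = 𝟙 C →
      (∀ P : ComplexPoints C, P ≫ (α ≫ α) ≠ P ∧ P ≫ (α ≫ α ≫ α) ≠ P) →
    ∀ (s : 𝒥.J ⟶ 𝒥.J), s = 𝒥.pushforward 𝒥 α →
    ∀ (sB ψ₀ : AbelianVariety.kerComponent (𝟙 𝒥.J - s + s ≫ s) ⟶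
        AbelianVariety.kerComponent (𝟙 𝒥.J - s + s ≫ s)),
      sB ≫ AbelianVariety.kerComponentι (𝟙 𝒥.J - s + s ≫ s) =
        AbelianVariety.kerComponentι (𝟙 𝒥.J - s + s ≫ s) ≫ s →
      ψ₀ = 𝟙 _ + 2 • (sB ≫ sB) →
      (AbelianVariety.kerComponent (𝟙 𝒥.J - s + s ≫ s)).dim = 8 ∧
      ∃ c ∈ weilClassesPlus (AbelianVariety.kerComponent (𝟙 𝒥.J - s + s ≫ s)) ψ₀ 4 3,
        c ∈ algebraicClasses (AbelianVariety.kerComponent (𝟙 𝒥.J - s + s ≫ s)).X 4 ∧ c ≠ 0) :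
    Schoen1988_cyclicPrym_weilClasses_algebraic_degreeSix := by
  have hX := Motives.abelianVarietyCohomologyExteriorH1_holds
  rw [Schoen1988_cyclicPrym_weilClasses_algebraic_degreeSix_iff_weilClassesOf]
  intro C 𝒥 α hC h25 hα hfree s hs sB ψ₀ hsB hψ₀
  obtain ⟨hdim, hex⟩ := h C 𝒥 α hC h25 hα hfree s hs sB ψ₀ hsB hψ₀
  have hb₁ : Module.finrank ℂ (complexBetti (AbelianVariety.kerComponent (𝟙 𝒥.J - s + s ≫ s)).X 1) =
      2 * (2 * 4) := by
    rw [hX.finrank_one, hdim]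
  exact weilClassesOf_le_algebraicClasses_of_exists_mem_weilClassesPlus (hX.hasExteriorCohomologyH1 _)
    hb₁ (by norm_num) (kerComponent_weilOperator_comp_self' hsB hψ₀) hex

/-- **It suffices to prove Schoen's fact on the `+`-line**: the named fact follows from the
algebraicity of the classes of the single typed eigenspace `Eig((2·𝟙 + ψ₀)^*, (2 + i√3)⁸) = E₊`
(complex conjugation carries it onto the other one and preserves algebraic classes).
[cite: vanGeemen1994HodgeAV, proof of Lemma 5.2 (6)] [cite: Schoen1988HodgeWeil, Cor. 3.1 (p. 24)] -/
theorem Schoen1988_cyclicPrym_weilClasses_algebraic_degreeSix_of_plus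
    (h : ∀ (C : SchemeOver ℂ) (𝒥 : Jacobian C) (α : C ⟶ C),
      IsSmoothProjective 1 C → 𝒥.J.dim = 25 →
      α ≫ α ≫ α ≫ α ≫ α ≫ α = 𝟙 C →
      (∀ P : ComplexPoints C, P ≫ (α ≫ α) ≠ P ∧ P ≫ (α ≫ α ≫ α) ≠ P) →
    ∀ (s : 𝒥.J ⟶ 𝒥.J), s = 𝒥.pushforward 𝒥 α →
    ∀ (sB ψ₀ : AbelianVariety.kerComponent (𝟙 𝒥.J - s + s ≫ s) ⟶
        AbelianVariety.kerComponent (𝟙 𝒥.J - s + s ≫ s)),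
      sB ≫ AbelianVariety.kerComponentι (𝟙 𝒥.J - s + s ≫ s) =
        AbelianVariety.kerComponentι (𝟙 𝒥.J - s + s ≫ s) ≫ s →
      ψ₀ = 𝟙 _ + 2 • (sB ≫ sB) →
    ∀ c : complexBetti (AbelianVariety.kerComponent (𝟙 𝒥.J - s + s ≫ s)).X 8,
      c ∈ Module.End.eigenspace
          (complexBetti.map
            ((2 : ℤ) • 𝟙 (AbelianVariety.kerComponent (𝟙 𝒥.J - s + s ≫ s)) + ψ₀).hom.hom.hom 8).hom
          ((2 + Complex.I * (Real.sqrt (3 : ℝ) : ℂ)) ^ 8) →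
      c ∈ algebraicClasses (AbelianVariety.kerComponent (𝟙 𝒥.J - s + s ≫ s)).X 4) :
    Schoen1988_cyclicPrym_weilClasses_algebraic_degreeSix := by
  have hX := Motives.abelianVarietyCohomologyExteriorH1_holds
  rw [Schoen1988_cyclicPrym_weilClasses_algebraic_degreeSix_iff_weilClassesOf]
  intro C 𝒥 α hC h25 hα hfree s hs sB ψ₀ hsB hψ₀
  refine weilClassesOf_le_algebraicClasses_of_weilClassesPlus_le fun c hc => ?_
  rw [← eigenspace_two_add_weilOperator_eq_weilClassesPlus (hX.hasExteriorCohomologyH1 _)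
    (kerComponent_weilOperator_comp_self' hsB hψ₀)] at hc
  exact h C 𝒥 α hC h25 hα hfree s hs sB ψ₀ hsB hψ₀ c hc

end SchoenFact

end Literature.AlgebraicGeometry.HodgeTheory

end
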